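import Mathlib
import Summits.Ventures.PercRepro2.SeriesEdge

/-!
# Series reduction, II: events and rows (blind cell PercRepro2, night-1 g9; NIGHT1-G9.md §8)

The preimages under `Φ` of the events of `HMFc` (connection, avoidance, `PD`, `T`, cluster and
residual-connection events) for marks `≠ x`, the transport of the cluster rows — a row `W ∌ x` of
the reduced graph is the union of the rows `W` and `W ∪ {x}` of the original, a row `W ∋ x` is
empty on the reduced side — and the transport of the per-row term `termW` on both kinds of rows
(`termW_series`, `termW_series_insert`); a row `W ∪ {x}` with `u, v ∉ W` is empty
(`clusterEvent_insert_eq_empty`).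
-/

namespace Summit.Ventures.PercRepro2

open UnionCluster CovForm

namespace SeriesEdge
section Events

variable {V : Type*} {E : Type*} [DecidableEq E] [Fintype V] [DecidableEq V]

variable {ends : E → Sym2 V} {e₁ e₂ : E} {u v x : V}
  (he₁ : ends e₁ = s(u, x)) (he₂ : ends e₂ = s(x, v)) (hx : ∀ e, x ∈ ends e → e = e₁ ∨ e = e₂)
  (hux : u ≠ x) (hvx : v ≠ x)
include he₁ he₂ hx hux hvx

omit [Fintype V] [DecidableEq V] in
/-- Connection events transport (vertices other than `x`). -/
lemma preimage_connEvent {a b : V} (ha : a ≠ x) (hb : b ≠ x) :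
    Φ e₁ e₂ ⁻¹' connEvent (ends' ends u v) a b = connEvent ends a b := by
  ext ω
  simp only [Set.mem_preimage, mem_connEvent, conn_series he₁ he₂ hx hux hvx ha hb]

omit [Fintype V] [DecidableEq V] in
/-- Avoidance events transport. -/
lemma preimage_avoidAll {a : V} (ha : a ≠ x) {X : Finset V} (hX : ∀ y ∈ X, y ≠ x) :
    Φ e₁ e₂ ⁻¹' avoidAll (ends' ends u v) a X = avoidAll ends a X := by
  ext ω
  simp only [Set.mem_preimage, avoidAll, Set.mem_setOf_eq]
  exact forall_congr' fun y => forall_congr' fun hy => by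
    rw [conn_series he₁ he₂ hx hux hvx ha (hX y hy)]

omit [Fintype V] [DecidableEq V] in
/-- `PD` transports. -/
lemma preimage_PDEvent {a₁ a₂ a₃ : V} (h1 : a₁ ≠ x) (h2 : a₂ ≠ x) (h3 : a₃ ≠ x) :
    Φ e₁ e₂ ⁻¹' PDEvent (ends' ends u v) a₁ a₂ a₃ = PDEvent ends a₁ a₂ a₃ := by
  ext ω
  simp only [Set.mem_preimage, PDEvent, Dtilde, UnionCluster.inU, Set.mem_inter_iff,
    Set.mem_compl_iff, Set.mem_union, mem_connEvent, conn_series he₁ he₂ hx hux hvx h1 h2,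
    conn_series he₁ he₂ hx hux hvx h3 h1, conn_series he₁ he₂ hx hux hvx h3 h2]

omit [Fintype V] [DecidableEq V] in
/-- `T` transports. -/
lemma preimage_TEvent {a₁ a₂ a₃ : V} (h1 : a₁ ≠ x) (h2 : a₂ ≠ x) (h3 : a₃ ≠ x) :
    Φ e₁ e₂ ⁻¹' TEvent (ends' ends u v) a₁ a₂ a₃ = TEvent ends a₁ a₂ a₃ := by
  ext ω
  simp only [Set.mem_preimage, TEvent, Set.mem_inter_iff, Set.mem_compl_iff, mem_connEvent,
    conn_series he₁ he₂ hx hux hvx h2 h1, conn_series he₁ he₂ hx hux hvx h2 h3]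

omit [Fintype V] [DecidableEq V] in
/-- The cluster of `a₃ ≠ x` in `Φ ω` is its cluster in `ω` without `x`. -/
lemma cluster_Φ {ω : Config E} {a₃ : V} (h3 : a₃ ≠ x) :
    cluster (ends' ends u v) (Φ e₁ e₂ ω) a₃ = cluster ends ω a₃ \ {x} := by
  ext y
  simp only [mem_cluster, Set.mem_sdiff, Set.mem_singleton_iff]
  constructor
  · intro h
    have hy : y ≠ x := ne_x_of_conn he₁ he₂ hx hux hvx h3 h
    exact ⟨(conn_series he₁ he₂ hx hux hvx h3 hy).1 h, hy⟩
  · rintro ⟨h, hy⟩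
    exact (conn_series he₁ he₂ hx hux hvx h3 hy).2 h

omit [Fintype V] [DecidableEq V] in
/-- The rows of `Φ ω` containing `x` are empty. -/
lemma preimage_clusterEvent_of_mem {a₃ : V} (h3 : a₃ ≠ x) {S : Set V} (hS : x ∈ S) :
    Φ e₁ e₂ ⁻¹' clusterEvent (ends' ends u v) a₃ S = ∅ := by
  ext ω
  simp only [Set.mem_preimage, mem_clusterEvent, Set.mem_empty_iff_false, iff_false]
  intro h
  rw [cluster_Φ he₁ he₂ hx hux hvx h3] at h
  have : x ∈ cluster ends ω a₃ \ {x} := h ▸ hS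
  exact this.2 rfl

omit [Fintype V] [DecidableEq V] in
/-- A row `S ∌ x` of `Φ ω` is the union of the rows `S` and `S ∪ {x}` of `ω`. -/
lemma preimage_clusterEvent {a₃ : V} (h3 : a₃ ≠ x) {S : Set V} (hS : x ∉ S) :
    Φ e₁ e₂ ⁻¹' clusterEvent (ends' ends u v) a₃ S =
      clusterEvent ends a₃ S ∪ clusterEvent ends a₃ (insert x S) := by
  ext ω
  simp only [Set.mem_preimage, mem_clusterEvent, Set.mem_union, cluster_Φ he₁ he₂ hx hux hvx h3]
  have hins : insert x S \ {x} = S := by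
    ext y
    simp only [Set.mem_sdiff, Set.mem_insert_iff, Set.mem_singleton_iff]
    constructor
    · rintro ⟨h | h, hne⟩
      · exact absurd h hne
      · exact h
    · intro hy
      exact ⟨Or.inr hy, fun hyx => hS (hyx ▸ hy)⟩
  constructor
  · intro h
    by_cases hxc : x ∈ cluster ends ω a₃
    · right
      rw [← h, Set.insert_sdiff_singleton, Set.insert_eq_of_mem hxc]
    · left
      rw [← h, Set.sdiff_singleton_eq_self hxc]
  · rintro (h | h)
    · rw [h, Set.sdiff_singleton_eq_self hS]
    · rw [h, hins]

omit hx hux hvx in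
/-- The restriction to the edges not touching `W ∌ x` commutes with `Φ`. -/
lemma restrict_Φ {W : Finset V} (hW : x ∉ W) (ω : Config E) :
    restrict (touches (ends' ends u v) (↑W : Set V))ᶜ (Φ e₁ e₂ ω) =
      Φ e₁ e₂ (restrict (touches ends (↑W : Set V))ᶜ ω) := by
  have hmem : ∀ e, e ∈ touches ends (↑W : Set V) ↔ some e ∈ touches (ends' ends u v) (↑W : Set V) :=
    fun e => Iff.rfl
  have hnone : none ∈ touches (ends' ends u v) (↑W : Set V) ↔ (u ∈ W ∨ v ∈ W) := by
    simp only [touches, Set.mem_setOf_eq, ends'_none, Finset.mem_coe]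
    constructor
    · rintro ⟨y, hy, z, h⟩
      rcases Sym2.eq_iff.1 h with ⟨rfl, _⟩ | ⟨_, rfl⟩
      · exact Or.inl hy
      · exact Or.inr hy
    · rintro (h | h)
      · exact ⟨u, h, v, rfl⟩
      · exact ⟨v, h, u, Sym2.eq_swap⟩
  have he1m : e₁ ∈ touches ends (↑W : Set V) ↔ u ∈ W := by
    simp only [touches, Set.mem_setOf_eq, he₁, Finset.mem_coe]
    constructor
    · rintro ⟨y, hy, z, h⟩
      rcases Sym2.eq_iff.1 h with ⟨huy, _⟩ | ⟨_, hxy⟩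
      · exact huy ▸ hy
      · exact absurd (hxy ▸ hy) hW
    · intro h; exact ⟨u, h, x, rfl⟩
  have he2m : e₂ ∈ touches ends (↑W : Set V) ↔ v ∈ W := by
    simp only [touches, Set.mem_setOf_eq, he₂, Finset.mem_coe]
    constructor
    · rintro ⟨y, hy, z, h⟩
      rcases Sym2.eq_iff.1 h with ⟨hxy, _⟩ | ⟨_, hvy⟩
      · exact absurd (hxy ▸ hy) hW
      · exact hvy ▸ hy
    · intro h; exact ⟨v, h, x, Sym2.eq_swap⟩
  funext e
  cases e with
  | none =>
    rw [Φ_none]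
    by_cases h : u ∈ W ∨ v ∈ W
    · rw [restrict_apply_of_notMem (show none ∉ (touches (ends' ends u v) (↑W : Set V))ᶜ from
        fun h' => h' (hnone.2 h))]
      rcases h with h | h
      · rw [restrict_apply_of_notMem (show e₁ ∉ (touches ends (↑W : Set V))ᶜ from
          fun h' => h' (he1m.2 h))]
        simp
      · rw [restrict_apply_of_notMem (show e₂ ∉ (touches ends (↑W : Set V))ᶜ from
          fun h' => h' (he2m.2 h))]
        simp
    · push Not at h
      rw [restrict_apply_of_mem (show none ∈ (touches (ends' ends u v) (↑W : Set V))ᶜ from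
        fun h' => h.1 (hnone.1 h' |>.resolve_right h.2)),
        restrict_apply_of_mem (show e₁ ∈ (touches ends (↑W : Set V))ᶜ from fun h' => h.1 (he1m.1 h')),
        restrict_apply_of_mem (show e₂ ∈ (touches ends (↑W : Set V))ᶜ from fun h' => h.2 (he2m.1 h'))]
      rfl
  | some e =>
    rw [Φ_some]
    by_cases h12 : e = e₁ ∨ e = e₂
    · rw [if_pos h12]
      by_cases hm : some e ∈ (touches (ends' ends u v) (↑W : Set V))ᶜ
      · rw [restrict_apply_of_mem hm, Φ_some, if_pos h12]
      · rw [restrict_apply_of_notMem hm]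
    · rw [if_neg h12]
      by_cases hm : some e ∈ (touches (ends' ends u v) (↑W : Set V))ᶜ
      · rw [restrict_apply_of_mem hm, Φ_some, if_neg h12,
          restrict_apply_of_mem (show e ∈ (touches ends (↑W : Set V))ᶜ from fun h' => hm ((hmem e).1 h'))]
      · rw [restrict_apply_of_notMem hm,
          restrict_apply_of_notMem (show e ∉ (touches ends (↑W : Set V))ᶜ from
            fun h' => hm (fun h'' => h' ((hmem e).2 h'')))]

/-- Residual connection events transport (`W ∌ x`, vertices other than `x`). -/
lemma preimage_connDelEvent {W : Finset V} (hW : x ∉ W) {a b : V} (ha : a ≠ x) (hb : b ≠ x) :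
    Φ e₁ e₂ ⁻¹' connDelEvent (ends' ends u v) W a b = connDelEvent ends W a b := by
  ext ω
  simp only [Set.mem_preimage, connDelEvent, Set.mem_setOf_eq,
    restrict_Φ he₁ he₂ hW, conn_series he₁ he₂ hx hux hvx ha hb]

/-- The residual `Q` transports. -/
lemma preimage_delQ {W : Finset V} (hW : x ∉ W) {a₁ a₂ : V} (h1 : a₁ ≠ x) (h2 : a₂ ≠ x) :
    Φ e₁ e₂ ⁻¹' delQ (ends' ends u v) W a₁ a₂ = delQ ends W a₁ a₂ := by
  unfold delQ
  rw [Set.preimage_compl, preimage_connDelEvent he₁ he₂ hx hux hvx hW h1 h2]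

end Events

section Rows

variable {V : Type*} {E : Type*} [Fintype E] [DecidableEq E] [Fintype V] [DecidableEq V]
  {R : Type*} [Field R] [LinearOrder R] [IsStrictOrderedRing R]

variable (p : E → R) {ends : E → Sym2 V} {e₁ e₂ : E} {u v x : V}
  (he₁ : ends e₁ = s(u, x)) (he₂ : ends e₂ = s(x, v)) (hx : ∀ e, x ∈ ends e → e = e₁ ∨ e = e₂)
  (hne : e₁ ≠ e₂) (hux : u ≠ x) (hvx : v ≠ x)
include he₁ he₂ hx hne hux hvx

omit [Fintype E] [LinearOrder R] [IsStrictOrderedRing R] hne hux hvx in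
/-- For `W ∌ x` with `u ∈ W` or `v ∈ W`, the restriction to the edges not touching `W ∪ {x}`
commutes with `Φ` as the restriction to the edges not touching `W` (the new edge is deleted on both
sides). -/
lemma restrict_Φ_insert {W : Finset V} (hW : x ∉ W) (huv : u ∈ W ∨ v ∈ W) (ω : Config E) :
    restrict (touches (ends' ends u v) (↑W : Set V))ᶜ (Φ e₁ e₂ ω) =
      Φ e₁ e₂ (restrict (touches ends (↑(insert x W) : Set V))ᶜ ω) := by
  rw [restrict_Φ he₁ he₂ hW ω]
  funext e
  cases e with
  | none =>
    rw [Φ_none, Φ_none]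
    have hin : ∀ e' ∈ ({e₁, e₂} : Finset E), e' ∉ (touches ends (↑(insert x W) : Set V))ᶜ := by
      intro e' he'
      simp only [Finset.mem_insert, Finset.mem_singleton] at he'
      intro h
      apply h
      rcases he' with rfl | rfl
      · exact ⟨x, by simp, u, by rw [he₁, Sym2.eq_swap]⟩
      · exact ⟨x, by simp, v, he₂⟩
    rw [restrict_apply_of_notMem (hin e₁ (by simp)), restrict_apply_of_notMem (hin e₂ (by simp))]
    rcases huv with h | h
    · rw [restrict_apply_of_notMem (show e₁ ∉ (touches ends (↑W : Set V))ᶜ from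
        fun h' => h' ⟨u, Finset.mem_coe.2 h, x, he₁⟩)]
      simp
    · rw [restrict_apply_of_notMem (show e₂ ∉ (touches ends (↑W : Set V))ᶜ from
        fun h' => h' ⟨v, Finset.mem_coe.2 h, x, by rw [he₂, Sym2.eq_swap]⟩)]
      simp
  | some e =>
    rw [Φ_some, Φ_some]
    by_cases h12 : e = e₁ ∨ e = e₂
    · rw [if_pos h12, if_pos h12]
    · rw [if_neg h12, if_neg h12]
      have hxe : x ∉ ends e := fun h => h12 (hx e h)
      have hmem : e ∈ (touches ends (↑W : Set V))ᶜ ↔ e ∈ (touches ends (↑(insert x W) : Set V))ᶜ := by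
        simp only [Set.mem_compl_iff, touches, Set.mem_setOf_eq, Finset.coe_insert,
          Set.mem_insert_iff, Finset.mem_coe]
        constructor
        · rintro h ⟨y, hy | hy, z, hz⟩
          · exact hxe (hy ▸ hz ▸ Sym2.mem_mk_left _ _)
          · exact h ⟨y, hy, z, hz⟩
        · rintro h ⟨y, hy, z, hz⟩
          exact h ⟨y, Or.inr hy, z, hz⟩
      by_cases hm : e ∈ (touches ends (↑W : Set V))ᶜ
      · rw [restrict_apply_of_mem hm, restrict_apply_of_mem (hmem.1 hm)]
      · rw [restrict_apply_of_notMem hm, restrict_apply_of_notMem (fun h => hm (hmem.2 h))]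

omit [Fintype E] [LinearOrder R] [IsStrictOrderedRing R] hne in
/-- Residual connection events on the rows `W ∪ {x}` (`u ∈ W` or `v ∈ W`). -/
lemma preimage_connDelEvent_insert {W : Finset V} (hW : x ∉ W) (huv : u ∈ W ∨ v ∈ W) {a b : V}
    (ha : a ≠ x) (hb : b ≠ x) :
    Φ e₁ e₂ ⁻¹' connDelEvent (ends' ends u v) W a b = connDelEvent ends (insert x W) a b := by
  ext ω
  simp only [Set.mem_preimage, connDelEvent, Set.mem_setOf_eq,
    restrict_Φ_insert he₁ he₂ hx hW huv, conn_series he₁ he₂ hx hux hvx ha hb]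

omit [LinearOrder R] [IsStrictOrderedRing R] in
/-- `termW` transports on the rows `W ∌ x`. -/
lemma termW_series {o a₁ a₂ b : V} (ho : o ≠ x) (h1 : a₁ ≠ x) (h2 : a₂ ≠ x) (hb : b ≠ x)
    {W : Finset V} (hW : x ∉ W) :
    termW (p' p e₁ e₂) (ends' ends u v) o a₁ a₂ b W = termW p ends o a₁ a₂ b W := by
  unfold termW termT termPD delConnProb delShareMass
  simp only [prob_series p hne, Set.preimage_inter, preimage_connDelEvent he₁ he₂ hx hux hvx hW h2 ho,
    preimage_connDelEvent he₁ he₂ hx hux hvx hW h1 ho, preimage_connDelEvent he₁ he₂ hx hux hvx hW h2 hb,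
    preimage_connDelEvent he₁ he₂ hx hux hvx hW h1 hb, preimage_delQ he₁ he₂ hx hux hvx hW h1 h2]

omit [LinearOrder R] [IsStrictOrderedRing R] in
/-- `termW` transports on the rows `W ∪ {x}` (`u ∈ W` or `v ∈ W`). -/
lemma termW_series_insert {o a₁ a₂ b : V} (ho : o ≠ x) (h1 : a₁ ≠ x) (h2 : a₂ ≠ x) (hb : b ≠ x)
    {W : Finset V} (hW : x ∉ W) (huv : u ∈ W ∨ v ∈ W) :
    termW (p' p e₁ e₂) (ends' ends u v) o a₁ a₂ b W = termW p ends o a₁ a₂ b (insert x W) := by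
  have m1 : a₁ ∈ insert x W ↔ a₁ ∈ W := by
    rw [Finset.mem_insert]; exact ⟨fun h => h.resolve_left h1, Or.inr⟩
  have m2 : a₂ ∈ insert x W ↔ a₂ ∈ W := by
    rw [Finset.mem_insert]; exact ⟨fun h => h.resolve_left h2, Or.inr⟩
  have mo : o ∈ insert x W ↔ o ∈ W := by
    rw [Finset.mem_insert]; exact ⟨fun h => h.resolve_left ho, Or.inr⟩
  have mb : b ∈ insert x W ↔ b ∈ W := by
    rw [Finset.mem_insert]; exact ⟨fun h => h.resolve_left hb, Or.inr⟩
  have hdelQ : Φ e₁ e₂ ⁻¹' delQ (ends' ends u v) W a₁ a₂ = delQ ends (insert x W) a₁ a₂ := by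
    unfold delQ
    rw [Set.preimage_compl, preimage_connDelEvent_insert he₁ he₂ hx hux hvx hW huv h1 h2]
  unfold termW termT termPD delConnProb delShareMass
  simp only [m1, m2, mo, mb, prob_series p hne, Set.preimage_inter, hdelQ,
    preimage_connDelEvent_insert he₁ he₂ hx hux hvx hW huv h2 ho,
    preimage_connDelEvent_insert he₁ he₂ hx hux hvx hW huv h1 ho,
    preimage_connDelEvent_insert he₁ he₂ hx hux hvx hW huv h2 hb,
    preimage_connDelEvent_insert he₁ he₂ hx hux hvx hW huv h1 hb]

omit [DecidableEq E] [Fintype E] [Fintype V] [LinearOrder R] [IsStrictOrderedRing R] hne hvx in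
/-- A row `W ∪ {x}` with `u, v ∉ W` is empty: `x` joins `C(a₃)` only through `u` or `v`. -/
lemma clusterEvent_insert_eq_empty {a₃ : V} (h3 : a₃ ≠ x) {W : Finset V}
    (huv : ¬ (u ∈ W ∨ v ∈ W)) :
    clusterEvent ends a₃ (↑(insert x W) : Set V) = ∅ := by
  ext ω
  simp only [mem_clusterEvent, Set.mem_empty_iff_false, iff_false]
  intro h
  have hxc : Conn ends ω a₃ x := by
    have : x ∈ cluster ends ω a₃ := by rw [h]; simp
    exact mem_cluster.1 this
  -- the vertices of `C(a₃)` other than `x` are closed under open adjacency: an open edge into `x`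
  -- is `e₁` from `u` or `e₂` from `v`, but `u, v ∉ W = C(a₃) \ {x}`
  have key : x ∈ {y | y ≠ x ∧ Conn ends ω a₃ y} := by
    refine mem_of_conn_of_closed ?_ ⟨h3, conn_refl ends ω a₃⟩ hxc
    intro y hy z hyz
    obtain ⟨hyx, hyc⟩ := hy
    rw [openGraph_adj] at hyz
    obtain ⟨_, e, he, hends⟩ := hyz
    refine ⟨?_, conn_trans hyc (conn_of_openAdj ⟨e, he, hends⟩)⟩
    intro hzx
    rw [hzx] at hends
    have hyW : y ∈ W := by
      have : y ∈ cluster ends ω a₃ := mem_cluster.2 hyc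
      rw [h] at this
      rcases Finset.mem_insert.1 (Finset.mem_coe.1 this) with h' | h'
      · exact absurd h' hyx
      · exact h'
    rcases hx e (hends ▸ Sym2.mem_mk_right _ _) with rfl | rfl
    · rw [he₁] at hends
      rcases Sym2.eq_iff.1 hends with ⟨h', _⟩ | ⟨h', _⟩
      · exact huv (Or.inl (h' ▸ hyW))
      · exact hux h'
    · rw [he₂] at hends
      rcases Sym2.eq_iff.1 hends with ⟨h', _⟩ | ⟨_, h'⟩
      · exact hyx h'.symm
      · exact huv (Or.inr (h' ▸ hyW))
  exact key.1 rfl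

end Rows

end SeriesEdge

end Summit.Ventures.PercRepro2
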